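import Summits.KontsevichZagierPeriods.KontsevichZagierPeriods.Theorems.UnfoldedStokesStokesGenerationFibrewiseRungScalingSwaps
import Summits.KontsevichZagierPeriods.KontsevichZagierPeriods.Theorems.UnfoldedStokesStokesGenerationFibrewiseClosureCongr
import Summits.KontsevichZagierPeriods.KontsevichZagierPeriods.Theorems.UnfoldedStokesStokesGenerationFibrewiseClosureMulFresh

/-!
# `StokesGeneration` (stmt-KontsevichZagierPeriods-3586) — line `fibrewise_stokes`, stub `stub_logPolylogProductHomotopy`

Registered rung stub PH2 (rung 24, wave 5) of the line `fibrewise_stokes` of the crux `StokesGeneration` (route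
UnfoldedStokes): the LOG × DILOGARITHM PRODUCT HOMOTOPY, used by the weight-three rung 26 (the functional
equation `Li₃(x) + Li₃(1−x) + Li₃(−x/(1−x)) − log(1−x)(Li₂(x) + Li₂(1−x)) − ½ log x log²(1−x) − ⅙ log³(1−x)
= const` modulo `Dec` along an algebraic path `x(v)`), where the products `log(1−x)·Li₂(x)` and
`log(1−x)·Li₂(1−x)` are products `(∫ ℓ du)·(∫∫ T ds dt)` of a one-dimensional family `ℓ(u,v)` and a
two-dimensional family `T(s,t,v)`. On the closed cube `[0,1]⁴` (`s = x 0`, `t = x 1`, `u = x 2`, homotopy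
parameter `v = x 3`), for an abstract one-dimensional parametric integrand `ℓ(u,v)` with `v`-derivative `ℓᵥ`
admitting a closed-form primitive `μ` in `u` (`∂_u μ = ℓᵥ`, `μ(0,v) = 0`) and an abstract two-dimensional
parametric integrand `T(s,t,v)` with `v`-derivative `Tᵥ` admitting a closed-form primitive `Θ` in `t`
(`∂_t Θ = Tᵥ`, `Θ(s,0,v) = 0`), all `ℚ`-semialgebraic and continuous on the closed square / cube, the function
`μ(1,v)T(s,t,v) + ℓ(u,v)Θ(s,1,v) − (ℓ(u,1)T(s,t,1) − ℓ(u,0)T(s,t,0))`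
is fibrewise-Stokes decomposable (`FibStokesDecomposable 4`, `Theorems/UnfoldedStokesDefs.lean`).

Proof. Three fibrewise Stokes elements on the same cube, no kink sets, no transcendence input:
* along `v` (direction `3`) with primitive `G₀ = ℓ(u,v) T(s,t,v)`, fibre derivative
  `D₀ = ℓᵥ(u,v)T(s,t,v) + ℓ(u,v)Tᵥ(s,t,v)` (product rule) and faces `ℓ(u,1)T(s,t,1) − ℓ(u,0)T(s,t,0)`;
* along `u` (direction `2`) with primitive `G₁ = −μ(u,v) T(s,t,v)`, fibre derivative `D₁ = −ℓᵥ(u,v)T(s,t,v)`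
  and faces `−μ(1,v)T(s,t,v) + μ(0,v)T(s,t,v) = −μ(1,v)T(s,t,v)`;
* along `t` (direction `1`) with primitive `G₂ = −ℓ(u,v) Θ(s,t,v)`, fibre derivative `D₂ = −ℓ(u,v)Tᵥ(s,t,v)`
  and faces `−ℓ(u,v)Θ(s,1,v) + ℓ(u,v)Θ(s,0,v) = −ℓ(u,v)Θ(s,1,v)`.
The three integrands `Dⱼ − (faces)` are carried by closed-cube representations (`exists_cubeRep`); the family
is decomposable (`fibStokesDecomposable_of_elements`), and its sum equals the displayed function at every
point of the cube (`D₀ + D₁ + D₂ = 0`), so `fibStokesDecomposable_congr_off_null` with the empty null set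
concludes. The data are read on the cube coordinates `(u,v) = (x 2, x 3)` and `(s,t,v) = (x 0, x 1, x 3)`
through `isSemialgebraicFunOn_comp_coord`.

References: D. Zagier, *The dilogarithm function* (2007), §I.2 and §II.1 (functional equations of `Li₂`,
`Li₃`); M. Kontsevich, D. Zagier, *Periods* (2001), §1.2 (rule (3), Newton–Leibniz/Stokes).
-/

noncomputable section

-- `Summit.KontsevichZagierPeriods.KontsevichZagierPeriods.…` is the tree's mandated layout (single-conjunct summit).
set_option linter.dupNamespace false

namespace Summit.KontsevichZagierPeriods.KontsevichZagierPeriods.Cruxes.StokesGeneration.FibrewiseStokes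

open MeasureTheory Set
open Literature.NumberTheory.Transcendental
open Literature.NumberTheory.Transcendental.KZ
open Literature.ModelTheory.ExponentialFields (IsSemialgebraic)

/-- Reading a two-variable function of the closed unit square on two coordinates `i, k` of the closed unit
cube `[0,1]⁴` preserves `ℚ`-semialgebraicity and continuity. [folklore] -/
private theorem logPolyHom_read₂ {F : ℝ → ℝ → ℝ}
    (hF : IsSemialgebraicFunOn ℚ (Set.pi Set.univ (fun _ : Fin 2 => Set.Icc (0:ℝ) 1)) (fun z => F (z 0) (z 1)))
    (hFc : ContinuousOn (fun z : Fin 2 → ℝ => F (z 0) (z 1)) (Set.pi Set.univ (fun _ : Fin 2 => Set.Icc (0:ℝ) 1)))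
    (i k : Fin 4) :
    IsSemialgebraicFunOn ℚ (Set.pi Set.univ (fun _ : Fin 4 => Set.Icc (0:ℝ) 1)) (fun x => F (x i) (x k)) ∧
      ContinuousOn (fun x : Fin 4 → ℝ => F (x i) (x k)) (Set.pi Set.univ (fun _ : Fin 4 => Set.Icc (0:ℝ) 1)) := by
  have hS : IsSemialgebraic ℚ (Set.pi Set.univ (fun _ : Fin 4 => Set.Icc (0:ℝ) 1)) := by
    rw [← cube_eq_pi]; exact isSemialgebraic_cube
  have hmaps : ∀ x ∈ Set.pi Set.univ (fun _ : Fin 4 => Set.Icc (0:ℝ) 1),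
      (fun j => x ((![i, k] : Fin 2 → Fin 4) j)) ∈ Set.pi Set.univ (fun _ : Fin 2 => Set.Icc (0:ℝ) 1) :=
    fun x hx => Set.mem_univ_pi.mpr fun j => (Set.mem_univ_pi.mp hx) _
  refine ⟨?_, ?_⟩
  · exact (isSemialgebraicFunOn_comp_coord hF (![i, k] : Fin 2 → Fin 4)).mono (fun x hx => hmaps x hx) hS
  · exact hFc.comp (continuous_pi fun j => continuous_apply ((![i, k] : Fin 2 → Fin 4) j)).continuousOn hmaps

/-- Reading a three-variable function of the closed unit cube `[0,1]³` on three coordinates `i, k, l` of the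
closed unit cube `[0,1]⁴` preserves `ℚ`-semialgebraicity and continuity. [folklore] -/
private theorem logPolyHom_read₃ {F : ℝ → ℝ → ℝ → ℝ}
    (hF : IsSemialgebraicFunOn ℚ (Set.pi Set.univ (fun _ : Fin 3 => Set.Icc (0:ℝ) 1))
      (fun z => F (z 0) (z 1) (z 2)))
    (hFc : ContinuousOn (fun z : Fin 3 → ℝ => F (z 0) (z 1) (z 2))
      (Set.pi Set.univ (fun _ : Fin 3 => Set.Icc (0:ℝ) 1)))
    (i k l : Fin 4) :
    IsSemialgebraicFunOn ℚ (Set.pi Set.univ (fun _ : Fin 4 => Set.Icc (0:ℝ) 1)) (fun x => F (x i) (x k) (x l)) ∧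
      ContinuousOn (fun x : Fin 4 → ℝ => F (x i) (x k) (x l))
        (Set.pi Set.univ (fun _ : Fin 4 => Set.Icc (0:ℝ) 1)) := by
  have hS : IsSemialgebraic ℚ (Set.pi Set.univ (fun _ : Fin 4 => Set.Icc (0:ℝ) 1)) := by
    rw [← cube_eq_pi]; exact isSemialgebraic_cube
  have hmaps : ∀ x ∈ Set.pi Set.univ (fun _ : Fin 4 => Set.Icc (0:ℝ) 1),
      (fun j => x ((![i, k, l] : Fin 3 → Fin 4) j)) ∈ Set.pi Set.univ (fun _ : Fin 3 => Set.Icc (0:ℝ) 1) :=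
    fun x hx => Set.mem_univ_pi.mpr fun j => (Set.mem_univ_pi.mp hx) _
  refine ⟨?_, ?_⟩
  · exact (isSemialgebraicFunOn_comp_coord hF (![i, k, l] : Fin 3 → Fin 4)).mono (fun x hx => hmaps x hx) hS
  · exact hFc.comp (continuous_pi fun j => continuous_apply ((![i, k, l] : Fin 3 → Fin 4) j)).continuousOn hmaps

/-- **Registered stub `stub_logPolylogProductHomotopy` (rung 24, PH2): the log × dilogarithm product
homotopy.** On `[0,1]⁴` (`s = x 0`, `t = x 1`, `u = x 2`, `v = x 3`) the three elements
`E_v[G = ℓ(u,v)T(s,t,v)]`, `E_u[G = −μ(u,v)T(s,t,v)]`, `E_t[G = −ℓ(u,v)Θ(s,t,v)]` certify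
`μ(1,v)T(s,t,v) + ℓ(u,v)Θ(s,1,v) − (ℓT|_{v=1} − ℓT|_{v=0}) ∈ Dec` for abstract `ℚ`-semialgebraic continuous
`ℓ, ℓᵥ = ∂_vℓ, μ = ∫₀ᵘ ℓᵥ` on the closed square and `T, Tᵥ = ∂_vT, Θ = ∫₀ᵗ Tᵥ` on the closed cube.
[cite: Zagier2007Dilogarithm, §I.2] -/
theorem stub_logPolylogProductHomotopy (ℓ ℓᵥ μ : ℝ → ℝ → ℝ) (T Tᵥ Θ : ℝ → ℝ → ℝ → ℝ)
    (hℓ : IsSemialgebraicFunOn ℚ (Set.pi Set.univ (fun _ : Fin 2 => Set.Icc (0:ℝ) 1)) (fun z => ℓ (z 0) (z 1)))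
    (hℓᵥ : IsSemialgebraicFunOn ℚ (Set.pi Set.univ (fun _ : Fin 2 => Set.Icc (0:ℝ) 1)) (fun z => ℓᵥ (z 0) (z 1)))
    (hμ : IsSemialgebraicFunOn ℚ (Set.pi Set.univ (fun _ : Fin 2 => Set.Icc (0:ℝ) 1)) (fun z => μ (z 0) (z 1)))
    (hT : IsSemialgebraicFunOn ℚ (Set.pi Set.univ (fun _ : Fin 3 => Set.Icc (0:ℝ) 1)) (fun z => T (z 0) (z 1) (z 2)))
    (hTᵥ : IsSemialgebraicFunOn ℚ (Set.pi Set.univ (fun _ : Fin 3 => Set.Icc (0:ℝ) 1)) (fun z => Tᵥ (z 0) (z 1) (z 2)))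
    (hΘ : IsSemialgebraicFunOn ℚ (Set.pi Set.univ (fun _ : Fin 3 => Set.Icc (0:ℝ) 1)) (fun z => Θ (z 0) (z 1) (z 2)))
    (hℓc : ContinuousOn (fun z : Fin 2 → ℝ => ℓ (z 0) (z 1)) (Set.pi Set.univ (fun _ : Fin 2 => Set.Icc (0:ℝ) 1)))
    (hℓᵥc : ContinuousOn (fun z : Fin 2 → ℝ => ℓᵥ (z 0) (z 1)) (Set.pi Set.univ (fun _ : Fin 2 => Set.Icc (0:ℝ) 1)))
    (hμc : ContinuousOn (fun z : Fin 2 → ℝ => μ (z 0) (z 1)) (Set.pi Set.univ (fun _ : Fin 2 => Set.Icc (0:ℝ) 1)))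
    (hTc : ContinuousOn (fun z : Fin 3 → ℝ => T (z 0) (z 1) (z 2)) (Set.pi Set.univ (fun _ : Fin 3 => Set.Icc (0:ℝ) 1)))
    (hTᵥc : ContinuousOn (fun z : Fin 3 → ℝ => Tᵥ (z 0) (z 1) (z 2)) (Set.pi Set.univ (fun _ : Fin 3 => Set.Icc (0:ℝ) 1)))
    (hΘc : ContinuousOn (fun z : Fin 3 → ℝ => Θ (z 0) (z 1) (z 2)) (Set.pi Set.univ (fun _ : Fin 3 => Set.Icc (0:ℝ) 1)))
    (hdv : ∀ u ∈ Set.Icc (0:ℝ) 1, ∀ v ∈ Set.Ioo (0:ℝ) 1, HasDerivAt (fun r => ℓ u r) (ℓᵥ u v) v)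
    (hdu : ∀ v ∈ Set.Icc (0:ℝ) 1, ∀ u ∈ Set.Ioo (0:ℝ) 1, HasDerivAt (fun r => μ r v) (ℓᵥ u v) u)
    (hμ0 : ∀ v ∈ Set.Icc (0:ℝ) 1, μ 0 v = 0)
    (hTd : ∀ s ∈ Set.Icc (0:ℝ) 1, ∀ t ∈ Set.Icc (0:ℝ) 1, ∀ v ∈ Set.Ioo (0:ℝ) 1,
      HasDerivAt (fun r => T s t r) (Tᵥ s t v) v)
    (hΘd : ∀ s ∈ Set.Icc (0:ℝ) 1, ∀ v ∈ Set.Icc (0:ℝ) 1, ∀ t ∈ Set.Ioo (0:ℝ) 1,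
      HasDerivAt (fun r => Θ s r v) (Tᵥ s t v) t)
    (hΘ0 : ∀ s ∈ Set.Icc (0:ℝ) 1, ∀ v ∈ Set.Icc (0:ℝ) 1, Θ s 0 v = 0) :
    FibStokesDecomposable 4 (fun x => μ 1 (x 3) * T (x 0) (x 1) (x 3) + ℓ (x 2) (x 3) * Θ (x 0) 1 (x 3) -
      (ℓ (x 2) 1 * T (x 0) (x 1) 1 - ℓ (x 2) 0 * T (x 0) (x 1) 0)) := by
  classical
  -- the data read on cube coordinates: the one-dimensional family on `(u, v) = (x 2, x 3)`, the
  -- two-dimensional family on `(s, t, v) = (x 0, x 1, x 3)`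
  obtain ⟨hLsa, hLc⟩ := logPolyHom_read₂ hℓ hℓc 2 3
  obtain ⟨hLVsa, hLVc⟩ := logPolyHom_read₂ hℓᵥ hℓᵥc 2 3
  obtain ⟨hMsa, hMc⟩ := logPolyHom_read₂ hμ hμc 2 3
  obtain ⟨hTsa, hTc'⟩ := logPolyHom_read₃ hT hTc 0 1 3
  obtain ⟨hTVsa, hTVc⟩ := logPolyHom_read₃ hTᵥ hTᵥc 0 1 3
  obtain ⟨hΘsa, hΘc'⟩ := logPolyHom_read₃ hΘ hΘc 0 1 3
  set C : Set (Fin 4 → ℝ) := Set.pi Set.univ (fun _ : Fin 4 => Set.Icc (0:ℝ) 1) with hC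
  have hCc : IsCompact C := isCompact_univ_pi fun _ => isCompact_Icc
  have hmem : ∀ x ∈ C, ∀ i, x i ∈ Set.Icc (0:ℝ) 1 := fun x hx i => (Set.mem_univ_pi.mp hx) i
  have hupd : ∀ x ∈ C, ∀ (i : Fin 4), ∀ s ∈ Set.Icc (0:ℝ) 1, Function.update x i s ∈ C :=
    fun x hx i s hs => update_mem_cubePi hx i hs
  have h03 : (0 : Fin 4) ≠ 3 := by decide
  have h13 : (1 : Fin 4) ≠ 3 := by decide
  have h23 : (2 : Fin 4) ≠ 3 := by decide
  have h02 : (0 : Fin 4) ≠ 2 := by decide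
  have h12 : (1 : Fin 4) ≠ 2 := by decide
  have h32 : (3 : Fin 4) ≠ 2 := by decide
  have h01 : (0 : Fin 4) ≠ 1 := by decide
  have h21 : (2 : Fin 4) ≠ 1 := by decide
  have h31 : (3 : Fin 4) ≠ 1 := by decide
  have h0I : (0:ℝ) ∈ Set.Icc (0:ℝ) 1 := ⟨le_rfl, zero_le_one⟩
  have h1I : (1:ℝ) ∈ Set.Icc (0:ℝ) 1 := ⟨zero_le_one, le_rfl⟩
  -- the witnesses
  obtain ⟨G0, hG0⟩ : ∃ G0 : (Fin 4 → ℝ) → ℝ, G0 = fun x => ℓ (x 2) (x 3) * T (x 0) (x 1) (x 3) := ⟨_, rfl⟩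
  obtain ⟨D0, hD0⟩ : ∃ D0 : (Fin 4 → ℝ) → ℝ,
      D0 = fun x => ℓᵥ (x 2) (x 3) * T (x 0) (x 1) (x 3) + ℓ (x 2) (x 3) * Tᵥ (x 0) (x 1) (x 3) := ⟨_, rfl⟩
  obtain ⟨G1, hG1⟩ : ∃ G1 : (Fin 4 → ℝ) → ℝ, G1 = fun x => -(μ (x 2) (x 3) * T (x 0) (x 1) (x 3)) := ⟨_, rfl⟩
  obtain ⟨D1, hD1⟩ : ∃ D1 : (Fin 4 → ℝ) → ℝ, D1 = fun x => -(ℓᵥ (x 2) (x 3) * T (x 0) (x 1) (x 3)) := ⟨_, rfl⟩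
  obtain ⟨G2, hG2⟩ : ∃ G2 : (Fin 4 → ℝ) → ℝ, G2 = fun x => -(ℓ (x 2) (x 3) * Θ (x 0) (x 1) (x 3)) := ⟨_, rfl⟩
  obtain ⟨D2, hD2⟩ : ∃ D2 : (Fin 4 → ℝ) → ℝ, D2 = fun x => -(ℓ (x 2) (x 3) * Tᵥ (x 0) (x 1) (x 3)) := ⟨_, rfl⟩
  have hG0sa : IsSemialgebraicFunOn ℚ C G0 := by rw [hG0]; exact hLsa.fun_mul hTsa
  have hD0sa : IsSemialgebraicFunOn ℚ C D0 := by
    rw [hD0]; exact (hLVsa.fun_mul hTsa).fun_add (hLsa.fun_mul hTVsa)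
  have hG1sa : IsSemialgebraicFunOn ℚ C G1 := by rw [hG1]; exact (hMsa.fun_mul hTsa).fun_neg
  have hD1sa : IsSemialgebraicFunOn ℚ C D1 := by rw [hD1]; exact (hLVsa.fun_mul hTsa).fun_neg
  have hG2sa : IsSemialgebraicFunOn ℚ C G2 := by rw [hG2]; exact (hLsa.fun_mul hΘsa).fun_neg
  have hD2sa : IsSemialgebraicFunOn ℚ C D2 := by rw [hD2]; exact (hLsa.fun_mul hTVsa).fun_neg
  have hG0c : ContinuousOn G0 C := by rw [hG0]; exact hLc.mul hTc'
  have hD0c : ContinuousOn D0 C := by rw [hD0]; exact (hLVc.mul hTc').add (hLc.mul hTVc)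
  have hG1c : ContinuousOn G1 C := by rw [hG1]; exact (hMc.mul hTc').neg
  have hD1c : ContinuousOn D1 C := by rw [hD1]; exact (hLVc.mul hTc').neg
  have hG2c : ContinuousOn G2 C := by rw [hG2]; exact (hLc.mul hΘc').neg
  have hD2c : ContinuousOn D2 C := by rw [hD2]; exact (hLc.mul hTVc).neg
  -- composition with the (semialgebraic, continuous) face maps `x ↦ x[i ↦ t]`, `t ∈ {0, 1}`
  have hface_sa : ∀ {F : (Fin 4 → ℝ) → ℝ}, IsSemialgebraicFunOn ℚ C F → ∀ (i : Fin 4) (t : ℝ), IsAlgebraic ℚ t →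
      t ∈ Set.Icc (0:ℝ) 1 → IsSemialgebraicFunOn ℚ C (fun x => F (Function.update x i t)) :=
    fun hF i t ht htI => IsSemialgebraicFunOn.comp_isSemialgebraicMapOn_holds hF
      (isSemialgebraicMapOn_update_const i ht) fun x hx => hupd x hx i t htI
  have hface_c : ∀ {F : (Fin 4 → ℝ) → ℝ}, ContinuousOn F C → ∀ (i : Fin 4) (t : ℝ), t ∈ Set.Icc (0:ℝ) 1 →
      ContinuousOn (fun x => F (Function.update x i t)) C :=
    fun hF i t htI => hF.comp (continuous_id.update i continuous_const).continuousOn fun x hx => hupd x hx i t htI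
  have hcu : ∀ (x : Fin 4 → ℝ) (i : Fin 4), Continuous fun s : ℝ => Function.update x i s :=
    fun x i => continuous_const.update i continuous_id
  -- the three integrands and their representations on the cube
  obtain ⟨I0, hI0⟩ : ∃ I0 : (Fin 4 → ℝ) → ℝ, I0 = fun x =>
      D0 x - (G0 (Function.update x 3 1) - G0 (Function.update x 3 0)) := ⟨_, rfl⟩
  obtain ⟨I1, hI1⟩ : ∃ I1 : (Fin 4 → ℝ) → ℝ, I1 = fun x =>
      D1 x - (G1 (Function.update x 2 1) - G1 (Function.update x 2 0)) := ⟨_, rfl⟩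
  obtain ⟨I2, hI2⟩ : ∃ I2 : (Fin 4 → ℝ) → ℝ, I2 = fun x =>
      D2 x - (G2 (Function.update x 1 1) - G2 (Function.update x 1 0)) := ⟨_, rfl⟩
  have hI0sa : IsSemialgebraicFunOn ℚ C I0 := by
    rw [hI0]
    exact hD0sa.fun_sub ((hface_sa hG0sa 3 1 isAlgebraic_one h1I).fun_sub (hface_sa hG0sa 3 0 isAlgebraic_zero h0I))
  have hI1sa : IsSemialgebraicFunOn ℚ C I1 := by
    rw [hI1]
    exact hD1sa.fun_sub ((hface_sa hG1sa 2 1 isAlgebraic_one h1I).fun_sub (hface_sa hG1sa 2 0 isAlgebraic_zero h0I))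
  have hI2sa : IsSemialgebraicFunOn ℚ C I2 := by
    rw [hI2]
    exact hD2sa.fun_sub ((hface_sa hG2sa 1 1 isAlgebraic_one h1I).fun_sub (hface_sa hG2sa 1 0 isAlgebraic_zero h0I))
  have hI0c : ContinuousOn I0 C := by
    rw [hI0]; exact hD0c.sub ((hface_c hG0c 3 1 h1I).sub (hface_c hG0c 3 0 h0I))
  have hI1c : ContinuousOn I1 C := by
    rw [hI1]; exact hD1c.sub ((hface_c hG1c 2 1 h1I).sub (hface_c hG1c 2 0 h0I))
  have hI2c : ContinuousOn I2 C := by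
    rw [hI2]; exact hD2c.sub ((hface_c hG2c 1 1 h1I).sub (hface_c hG2c 1 0 h0I))
  obtain ⟨q0, hq0d, hq0i⟩ := exists_cubeRep 4 I0 hI0sa hI0c
  obtain ⟨q1, hq1d, hq1i⟩ := exists_cubeRep 4 I1 hI1sa hI1c
  obtain ⟨q2, hq2d, hq2i⟩ := exists_cubeRep 4 I2 hI2sa hI2c
  -- bounds
  have hbound : ∀ {F : (Fin 4 → ℝ) → ℝ}, ContinuousOn F C → ∃ B : ℝ, ∀ x ∈ C, |F x| ≤ B := fun hF => by
    obtain ⟨B, hB⟩ := hCc.exists_bound_of_continuousOn hF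
    exact ⟨B, fun x hx => by simpa [Real.norm_eq_abs] using hB x hx⟩
  -- assemble the three elements
  have hdec : FibStokesDecomposable 4
      (fun x => ∑ j, ((![q0, q1, q2] : Fin 3 → IntegralRep 4) j).integrand x) := by
    refine fibStokesDecomposable_of_elements (M := 4) (J := 3) (![3, 2, 1] : Fin 3 → Fin 4)
      (![G0, G1, G2] : Fin 3 → (Fin 4 → ℝ) → ℝ) (![D0, D1, D2] : Fin 3 → (Fin 4 → ℝ) → ℝ)
      (![q0, q1, q2] : Fin 3 → IntegralRep 4) ?_ ?_
    · refine Fin.forall_fin_succ.mpr ⟨?_, Fin.forall_fin_two.mpr ⟨?_, ?_⟩⟩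
      · -- element 0, along `v = x 3`
        simp only [Matrix.cons_val_zero]
        refine ⟨hG0sa, hD0sa, hbound hG0c, fun x hx => ?_, fun x hx hx3' => ?_⟩
        · show ContinuousOn (fun s : ℝ => G0 (Function.update x 3 s)) (Set.Icc (0:ℝ) 1)
          exact hG0c.comp (hcu x 3).continuousOn fun s hs => hupd x hx 3 s hs
        · show HasDerivAt (fun s : ℝ => G0 (Function.update x 3 s)) (D0 x) (x 3)
          have hfun : (fun s : ℝ => G0 (Function.update x 3 s)) =
              fun s => ℓ (x 2) s * T (x 0) (x 1) s := by
            funext s; rw [hG0]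
            simp only [Function.update_self, Function.update_of_ne h03, Function.update_of_ne h13,
              Function.update_of_ne h23]
          rw [hfun, hD0]
          exact (hdv (x 2) (hmem x hx 2) (x 3) hx3').mul
            (hTd (x 0) (hmem x hx 0) (x 1) (hmem x hx 1) (x 3) hx3')
      · -- element 1, along `u = x 2`
        simp only [Fin.succ_zero_eq_one, Matrix.cons_val_one, Matrix.cons_val_zero]
        refine ⟨hG1sa, hD1sa, hbound hG1c, fun x hx => ?_, fun x hx hx2' => ?_⟩
        · show ContinuousOn (fun s : ℝ => G1 (Function.update x 2 s)) (Set.Icc (0:ℝ) 1)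
          exact hG1c.comp (hcu x 2).continuousOn fun s hs => hupd x hx 2 s hs
        · show HasDerivAt (fun s : ℝ => G1 (Function.update x 2 s)) (D1 x) (x 2)
          have hfun : (fun s : ℝ => G1 (Function.update x 2 s)) =
              fun s => -(μ s (x 3) * T (x 0) (x 1) (x 3)) := by
            funext s; rw [hG1]
            simp only [Function.update_self, Function.update_of_ne h02, Function.update_of_ne h12,
              Function.update_of_ne h32]
          rw [hfun, hD1]
          exact ((hdu (x 3) (hmem x hx 3) (x 2) hx2').mul_const (T (x 0) (x 1) (x 3))).neg
      · -- element 2, along `t = x 1`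
        simp only [Fin.succ_one_eq_two, Matrix.cons_val_two, Matrix.tail_cons, Matrix.head_cons]
        refine ⟨hG2sa, hD2sa, hbound hG2c, fun x hx => ?_, fun x hx hx1' => ?_⟩
        · show ContinuousOn (fun s : ℝ => G2 (Function.update x 1 s)) (Set.Icc (0:ℝ) 1)
          exact hG2c.comp (hcu x 1).continuousOn fun s hs => hupd x hx 1 s hs
        · show HasDerivAt (fun s : ℝ => G2 (Function.update x 1 s)) (D2 x) (x 1)
          have hfun : (fun s : ℝ => G2 (Function.update x 1 s)) =
              fun s => -(ℓ (x 2) (x 3) * Θ (x 0) s (x 3)) := by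
            funext s; rw [hG2]
            simp only [Function.update_self, Function.update_of_ne h01, Function.update_of_ne h21,
              Function.update_of_ne h31]
          rw [hfun, hD2]
          exact ((hΘd (x 0) (hmem x hx 0) (x 3) (hmem x hx 3) (x 1) hx1').const_mul (ℓ (x 2) (x 3))).neg
    · refine Fin.forall_fin_succ.mpr ⟨?_, Fin.forall_fin_two.mpr ⟨?_, ?_⟩⟩
      · simp only [Matrix.cons_val_zero]
        exact ⟨hq0d, fun x _ => by rw [hq0i, hI0]⟩
      · simp only [Fin.succ_zero_eq_one, Matrix.cons_val_one, Matrix.cons_val_zero]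
        exact ⟨hq1d, fun x _ => by rw [hq1i, hI1]⟩
      · simp only [Fin.succ_one_eq_two, Matrix.cons_val_two, Matrix.tail_cons, Matrix.head_cons]
        exact ⟨hq2d, fun x _ => by rw [hq2i, hI2]⟩
  -- the pointwise identity on the cube
  refine fibStokesDecomposable_congr_off_null 4 _ _ ∅
    Literature.ModelTheory.ExponentialFields.isSemialgebraic_empty measure_empty (fun x hx _ => ?_) hdec
  have hface0 : G0 (Function.update x 3 1) - G0 (Function.update x 3 0) =
      ℓ (x 2) 1 * T (x 0) (x 1) 1 - ℓ (x 2) 0 * T (x 0) (x 1) 0 := by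
    rw [hG0]
    simp only [Function.update_self, Function.update_of_ne h03, Function.update_of_ne h13,
      Function.update_of_ne h23]
  have hface1 : G1 (Function.update x 2 1) - G1 (Function.update x 2 0) =
      -(μ 1 (x 3) * T (x 0) (x 1) (x 3)) := by
    rw [hG1]
    simp only [Function.update_self, Function.update_of_ne h02, Function.update_of_ne h12,
      Function.update_of_ne h32, hμ0 (x 3) (hmem x hx 3), zero_mul, neg_zero, sub_zero]
  have hface2 : G2 (Function.update x 1 1) - G2 (Function.update x 1 0) =
      -(ℓ (x 2) (x 3) * Θ (x 0) 1 (x 3)) := by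
    rw [hG2]
    simp only [Function.update_self, Function.update_of_ne h01, Function.update_of_ne h21,
      Function.update_of_ne h31, hΘ0 (x 0) (hmem x hx 0) (x 3) (hmem x hx 3), mul_zero, neg_zero, sub_zero]
  simp only [Fin.sum_univ_three, Matrix.cons_val_zero, Matrix.cons_val_one, Matrix.cons_val_two, Matrix.tail_cons,
    Matrix.head_cons, hq0i, hq1i, hq2i, hI0, hI1, hI2, hface0, hface1, hface2, hD0, hD1, hD2]
  ring

end Summit.KontsevichZagierPeriods.KontsevichZagierPeriods.Cruxes.StokesGeneration.FibrewiseStokes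

end
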